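import Summits.CriticalPhenomena.PercolationContinuityZ3.Theorems.PercNearOneGluingNoHeavyLowerTailRefinedRowR1
import Mathlib.Tactic.Linarith
import HarnessLib

/-!
# `NoHeavyLowerTail` (stmt-CriticalPhenomena-4575) — the hub inequality (SPLIT) `WALL · HANG ≤ IN · LOOSE` is the instance
# `EA(S; {c}, {c}, {c})` of prim-ineq-gen-2's family `EA`: the bridge

Support file (prover prim-gen-kcluster gen 38; `--supports stmt-CriticalPhenomena-4575`).  No named facts, no sorries, no definitions.

KCLUSTER-gen37 §1 (run/shared/lean/prim/prim-gen-kcluster/) reduced the refined row R1 to the hub inequality **(SPLIT)(H;a,c;S)**: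
`PrW(WALL) · PrW(HANG) ≤ PrW(IN) · PrW(LOOSE)` for the four hub cells of `…RefinedRowR1WallTransport` (`RefinedRowR1.cellWall`,
`cellHang`, `cellIn`, `cellLoose`: the cluster `K = cl X a` hits `S` and, respectively, misses `c` while meeting every `S–c` path of the
support / misses `c` with `c` hanging on `S` / contains `c` / the rest), and recorded (SPLIT) as OPEN.  It is the instance `M = S`,
`X = Y = N = {c}` of prim-ineq-gen-2's **Theorem 1** `DualBHK.ea_univ` (`t(M,X) · e₂(M;Y,N) ≤ Ξ(M;X∩Y) · e₄(X∪Y;M)`, file `…DualBHKEA.lean`,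
2026-08-20; memo run/shared/lean/prim/prim-ineq-gen-2/DUAL-BHK.md §8): with one glued hub `S` and forced set `∅`,
`t(S,{c}) = IN ⊔ HANG` (`= RefinedRowR1.attached`), `e₂(S;{c},{c}) = WALL`, `Ξ(S;{c}) = WALL ⊔ LOOSE`, `e₄({c};S) = IN`, so EA reads
`(IN + HANG) · WALL ≤ (WALL + LOOSE) · IN`, i.e. (SPLIT).  Contents:
* `reach_sup_gl_cases` / `reach_sup_gl_of_cases` — reachability in a graph with one glued vertex set `A` (`G ⊔ DualBHK.gl A`): `x ⤳ z` iff
  `z` is in the `G`-class of `x`, or that class meets `A` and `z` is in the `G`-class of a vertex of `A`;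
* `sG_plain_reach_iff`, `sG_hub_reach_iff`, `resG_compl_eq` — prim-ineq-gen-2's structure graphs inside a universe containing all endpoints,
  read in the Gladkov-cluster vocabulary `cl`, `touch`;
* `attached_eq_union`, **`split_PrW`** — (SPLIT) on every finite weighted graph, for every apex `a`, vertex `c` and vertex set `S`.
[this work; the inequality is prim-ineq-gen-2's `DualBHK.ea_univ`]
-/

noncomputable section

namespace Summit.CriticalPhenomena.PercolationContinuityZ3.Theorems

namespace RefinedRowR1

open Finset SimpleGraph Literature.Probability.Percolation Literature.Probability.Percolation.DecisionTree
open Literature.Probability.Percolation.Gladkov ThreePointLB RefinedRowR3 RefinedRowR2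
open scoped Classical

variable {V : Type*} [Fintype V] [DecidableEq V]

/-! ### Reachability with one glued vertex set -/

omit [Fintype V] [DecidableEq V] in
/-- In `G ⊔ gl A` a walk from `x` either stays in the `G`-class of `x`, or that class meets `A` and the endpoint lies in the `G`-class of a
vertex of `A`. [folklore] -/
theorem reach_sup_gl_cases {G : SimpleGraph V} {A : Set V} {x z : V} (h : (G ⊔ DualBHK.gl A).Reachable x z) :
    G.Reachable x z ∨ ((∃ s ∈ A, G.Reachable x s) ∧ ∃ s' ∈ A, G.Reachable s' z) := by
  obtain ⟨w⟩ := h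
  induction w with
  | nil => exact Or.inl (Reachable.refl _)
  | @cons u v y huv _ ih =>
    rw [sup_adj, DualBHK.gl_adj] at huv
    rcases huv with huv | ⟨_, hu, hv⟩
    · rcases ih with h | ⟨⟨s, hs, hvs⟩, h2⟩
      · exact Or.inl (huv.reachable.trans h)
      · exact Or.inr ⟨⟨s, hs, huv.reachable.trans hvs⟩, h2⟩
    · rcases ih with h | ⟨_, h2⟩
      · exact Or.inr ⟨⟨u, hu, Reachable.refl _⟩, ⟨v, hv, h⟩⟩
      · exact Or.inr ⟨⟨u, hu, Reachable.refl _⟩, h2⟩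

omit [Fintype V] [DecidableEq V] in
/-- Converse of `reach_sup_gl_cases`. [folklore] -/
theorem reach_sup_gl_of_cases {G : SimpleGraph V} {A : Set V} {x z : V}
    (h : G.Reachable x z ∨ ((∃ s ∈ A, G.Reachable x s) ∧ ∃ s' ∈ A, G.Reachable s' z)) :
    (G ⊔ DualBHK.gl A).Reachable x z := by
  have hle : G ≤ G ⊔ DualBHK.gl A := le_sup_left
  rcases h with h | ⟨⟨s, hs, hxs⟩, ⟨s', hs', hsz⟩⟩
  · exact h.mono hle
  · refine ((hxs.mono hle).trans ?_).trans (hsz.mono hle)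
    by_cases hss : s = s'
    · subst hss; exact Reachable.refl _
    · exact Adj.reachable ((sup_adj _ _ _ _).2 (Or.inr (DualBHK.gl_adj.2 ⟨hss, hs, hs'⟩)))

/-! ### prim-ineq-gen-2's structure graphs in the cluster vocabulary -/

section Glue

variable {U : Finset V} {X : Finset (Sym2 V)} (hU : ∀ e ∈ X, ∀ z, z ∈ e → z ∈ U)
include hU

omit [DecidableEq V] in
/-- With at most singleton hubs the structure graph is the open graph: reachability is membership in `cl`. [folklore] -/
theorem sG_plain_reach_iff {A B : Set V} (hA : A.Subsingleton) (hB : B.Subsingleton) {x z : V} :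
    (DualBHK.sG U X A B).Reachable x z ↔ z ∈ cl X x := by
  rw [DualBHK.sG_eq_fromEdgeSet hU hA hB, mem_cl]
  rfl

omit [DecidableEq V] in
/-- One glued hub `S` (second hub at most a singleton): `z` is reached from `x` iff `z ∈ cl X x`, or `cl X x` meets `S` and `z ∈ cl X s′`
for some `s′ ∈ S`. [folklore] -/
theorem sG_hub_reach_iff {B : Set V} (hB : B.Subsingleton) (S : Finset V) {x z : V} :
    (DualBHK.sG U X (↑S : Set V) B).Reachable x z ↔
      z ∈ cl X x ∨ ((∃ s ∈ S, s ∈ cl X x) ∧ ∃ s' ∈ S, z ∈ cl X s') := by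
  have hG : DualBHK.sG U X (↑S : Set V) B = fromEdgeSet (↑X : Set (Sym2 V)) ⊔ DualBHK.gl (↑S : Set V) := by
    rw [DualBHK.sG, DualBHK.gl_subsingleton hB, sup_bot_eq, DualBHK.og_eq_fromEdgeSet hU]
  rw [hG]
  constructor
  · intro h
    rcases reach_sup_gl_cases h with h | ⟨⟨s, hs, h1⟩, ⟨s', hs', h2⟩⟩
    · exact Or.inl (mem_cl.2 h)
    · exact Or.inr ⟨⟨s, Finset.mem_coe.1 hs, mem_cl.2 h1⟩, ⟨s', Finset.mem_coe.1 hs', mem_cl.2 h2⟩⟩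
  · rintro (h | ⟨⟨s, hs, h1⟩, ⟨s', hs', h2⟩⟩)
    · exact reach_sup_gl_of_cases (Or.inl (mem_cl.1 h))
    · exact reach_sup_gl_of_cases (Or.inr ⟨⟨s, Finset.mem_coe.2 hs, mem_cl.1 h1⟩, ⟨s', Finset.mem_coe.2 hs', mem_cl.1 h2⟩⟩)

end Glue

/-- The support restricted to the complement of a vertex set `K` is the open graph of `D ∖ touch K` (inside a universe containing all
endpoints of `D`). [folklore] -/
theorem resG_compl_eq {U : Finset V} {D : Finset (Sym2 V)} (hUD : ∀ e ∈ D, ∀ z, z ∈ e → z ∈ U) (K : Finset V) :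
    DualBHK.resG U D {z | z ∉ K} = fromEdgeSet (↑(D \ touch K) : Set (Sym2 V)) := by
  ext x y
  rw [DualBHK.resG_adj, DualBHK.og_adj, fromEdgeSet_adj, Finset.mem_coe, Finset.mem_sdiff, mk_mem_touch, Set.mem_setOf_eq,
    Set.mem_setOf_eq]
  constructor
  · rintro ⟨⟨hD, -, -, hne⟩, hx, hy⟩
    exact ⟨⟨hD, fun h => h.elim hx hy⟩, hne⟩
  · rintro ⟨⟨hD, hK⟩, hne⟩
    exact ⟨⟨hD, hUD _ hD x (Sym2.mem_mk_left x y), hUD _ hD y (Sym2.mem_mk_right x y), hne⟩, fun h => hK (Or.inl h),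
      fun h => hK (Or.inr h)⟩

/-! ### (SPLIT) -/

omit [DecidableEq V] in
/-- `attached = IN ⊔ HANG`. [this work] -/
theorem attached_eq_union (a c : V) (S : Finset V) : attached a c S = cellIn a c S ∪ cellHang a c S := by
  ext X
  simp only [Set.mem_union, mem_attached, mem_cellIn, cellHang, Set.mem_setOf_eq]
  constructor
  · rintro ⟨hhit, hca | hcs⟩
    · exact Or.inl ⟨hhit, hca⟩
    · by_cases hca : c ∈ cl X a
      · exact Or.inl ⟨hhit, hca⟩
      · exact Or.inr ⟨hhit, hca, hcs⟩
  · rintro (⟨hhit, hca⟩ | ⟨hhit, _, hcs⟩)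
    · exact ⟨hhit, Or.inl hca⟩
    · exact ⟨hhit, Or.inr hcs⟩

section Split

variable (D : Finset (Sym2 V)) {p : Sym2 V → ℝ} (hp0 : ∀ e, 0 ≤ p e) (hp1 : ∀ e, p e ≤ 1) (a c : V) (S : Finset V)
include hp0 hp1

/-- **(SPLIT)** (KCLUSTER-gen37 §1): on every finite weighted graph, for every apex `a`, vertex `c` and vertex set `S`,
`PrW(WALL) · PrW(HANG) ≤ PrW(IN) · PrW(LOOSE)` — the instance `EA(S;{c},{c},{c})` of prim-ineq-gen-2's `DualBHK.ea_univ`.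
[this work; = `DualBHK.ea_univ`] -/
theorem split_PrW :
    PrW D p (cellWall D a c S) * PrW D p (cellHang a c S) ≤ PrW D p (cellIn a c S) * PrW D p (cellLoose D a c S) := by
  -- the universe: all endpoints of `D`, the apex, `c` and `S`
  set U : Finset V := D.biUnion Sym2.toFinset ∪ insert a (insert c S) with hUdef
  have haU : a ∈ U := Finset.mem_union_right _ (Finset.mem_insert_self _ _)
  have hSU : (↑S : Set V) ⊆ ↑U := by
    intro x hx
    rw [Finset.mem_coe] at hx ⊢
    exact Finset.mem_union_right _ (Finset.mem_insert_of_mem (Finset.mem_insert_of_mem hx))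
  have hcU : ({c} : Set V) ⊆ ↑U := by
    intro x hx
    rw [Set.mem_singleton_iff.1 hx, Finset.mem_coe]
    exact Finset.mem_union_right _ (Finset.mem_insert_of_mem (Finset.mem_insert_self _ _))
  have hE : ∀ X, X ⊆ D → ∀ e ∈ X, ∀ z, z ∈ e → z ∈ U := fun X hX e he z hz =>
    Finset.mem_union_left _ (Finset.mem_biUnion.2 ⟨e, hX he, Sym2.mem_toFinset.2 hz⟩)
  have hc1 : ({c} : Set V).Subsingleton := Set.subsingleton_singleton
  have he1 : (∅ : Set V).Subsingleton := Set.subsingleton_empty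
  -- Theorem 1 of prim-ineq-gen-2 at `EA(S; {c}, {c}, {c})`
  have hEA := DualBHK.ea_univ (D := D) (F := ∅) (E := D) (p := p) (a := a) hp0 hp1 subset_rfl (Finset.empty_subset D) U
    (↑S) {c} {c} {c} haU hSU hcU le_rfl le_rfl
  rw [Set.inter_self, Set.union_self] at hEA
  -- factor 1: `t(S,{c}) = attached = IN ⊔ HANG`
  have e1 : PrW D p (DualBHK.evT U ∅ a (↑S) {c}) = PrW D p (cellIn a c S) + PrW D p (cellHang a c S) := by
    have hdisj : Disjoint (cellIn a c S) (cellHang a c S) := Set.disjoint_left.2 fun X h1 h2 => h2.2.1 h1.2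
    rw [← PrW_union D p hdisj, ← attached_eq_union]
    refine le_antisymm (PrW_mono D hp0 hp1 fun X hX h => ?_) (PrW_mono D hp0 hp1 fun X hX h => ?_)
    · rw [DualBHK.mem_evT, Finset.union_empty] at h
      obtain ⟨⟨m, hm, hrm⟩, ⟨x, hx, hrx⟩⟩ := h
      rw [Set.mem_singleton_iff] at hx
      subst hx
      rw [sG_hub_reach_iff (hE X hX) hc1 S] at hrm hrx
      have hhit : X ∈ hit a S := by
        rcases hrm with hrm | ⟨hh, _⟩
        · exact ⟨m, Finset.mem_coe.1 hm, hrm⟩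
        · exact hh
      refine ⟨hhit, ?_⟩
      rcases hrx with hrx | ⟨_, s', hs', hcs'⟩
      · exact Or.inl hrx
      · exact Or.inr ⟨s', hs', hcs'⟩
    · obtain ⟨⟨s, hs, hsa⟩, hatt⟩ := h
      rw [DualBHK.mem_evT, Finset.union_empty]
      refine ⟨⟨s, Finset.mem_coe.2 hs, (sG_hub_reach_iff (hE X hX) hc1 S).2 (Or.inl hsa)⟩, ⟨c, rfl, ?_⟩⟩
      rw [sG_hub_reach_iff (hE X hX) hc1 S]
      rcases hatt with hca | ⟨s', hs', hcs'⟩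
      · exact Or.inl hca
      · exact Or.inr ⟨⟨s, hs, hsa⟩, ⟨s', hs', hcs'⟩⟩
  -- factor 2: `e₂(S;{c},{c}) = WALL`
  have e2 : PrW D p (DualBHK.evE2 U D ∅ a (↑S) {c} {c}) = PrW D p (cellWall D a c S) := by
    refine le_antisymm (PrW_mono D hp0 hp1 fun X hX h => ?_) (PrW_mono D hp0 hp1 fun X hX h => ?_)
    · rw [DualBHK.mem_evE2, Finset.union_empty] at h
      obtain ⟨⟨m, hm, hrm⟩, hy, hsep⟩ := h
      have hplain : ∀ z, (DualBHK.sG U X ∅ ∅).Reachable a z ↔ z ∈ cl X a := fun z => sG_plain_reach_iff (hE X hX) he1 he1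
      have hca : c ∉ cl X a := fun h => hy c rfl ((hplain c).2 h)
      refine ⟨⟨m, Finset.mem_coe.1 hm, (hplain m).1 hrm⟩, hca, fun s hs => ?_⟩
      by_cases hsa : s ∈ cl X a
      · exact Or.inl hsa
      · refine Or.inr fun hc => ?_
        refine (DualBHK.mem_sepEv.1 hsep) s (Finset.mem_coe.2 hs) c rfl ⟨fun h => hsa ((hplain s).1 h), fun h => hca ((hplain c).1 h), ?_⟩
        have hW : {z | ¬ (DualBHK.sG U X ∅ ∅).Reachable a z} = {z | z ∉ cl X a} := by
          ext z; simp only [Set.mem_setOf_eq, hplain z]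
        rw [hW, resG_compl_eq (hE D subset_rfl) (cl X a)]
        exact mem_cl.1 hc
    · obtain ⟨hhit, hca, hw⟩ := h
      obtain ⟨s₀, hs₀, hs₀a⟩ := hhit
      have hplain : ∀ z, (DualBHK.sG U X ∅ ∅).Reachable a z ↔ z ∈ cl X a := fun z => sG_plain_reach_iff (hE X hX) he1 he1
      rw [DualBHK.mem_evE2, Finset.union_empty]
      refine ⟨⟨s₀, Finset.mem_coe.2 hs₀, (hplain s₀).2 hs₀a⟩, fun y hy h => ?_, ?_⟩
      · rw [Set.mem_singleton_iff] at hy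
        subst hy
        exact hca ((hplain _).1 h)
      · refine DualBHK.mem_sepEv.2 fun s hs q hq => ?_
        rintro ⟨hns, -, hreach⟩
        rw [Set.mem_singleton_iff] at hq
        subst hq
        rcases hw s (Finset.mem_coe.1 hs) with hsa | hSep
        · exact hns ((hplain s).2 hsa)
        · have hW : {z | ¬ (DualBHK.sG U X ∅ ∅).Reachable a z} = {z | z ∉ cl X a} := by
            ext z; simp only [Set.mem_setOf_eq, hplain z]
          rw [hW, resG_compl_eq (hE D subset_rfl) (cl X a)] at hreach
          exact hSep (mem_cl.2 hreach)
  -- factor 3: `Ξ(S;{c}) = WALL ⊔ LOOSE`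
  have e3 : PrW D p (DualBHK.evXi U ∅ a (↑S) {c}) = PrW D p (cellWall D a c S) + PrW D p (cellLoose D a c S) := by
    have hdisj : Disjoint (cellWall D a c S) (cellLoose D a c S) := Set.disjoint_left.2 fun X h1 h2 => h2.2.2 h1
    rw [← PrW_union D p hdisj]
    refine le_antisymm (PrW_mono D hp0 hp1 fun X hX h => ?_) (PrW_mono D hp0 hp1 fun X hX h => ?_)
    · rw [DualBHK.mem_evXi, Finset.union_empty] at h
      obtain ⟨⟨m, hm, hrm⟩, hZ⟩ := h
      rw [sG_hub_reach_iff (hE X hX) he1 S] at hrm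
      have hc := hZ c rfl
      rw [sG_hub_reach_iff (hE X hX) he1 S] at hc
      push Not at hc
      have hhit : X ∈ hit a S := by
        rcases hrm with hrm | ⟨hh, _⟩
        · exact ⟨m, Finset.mem_coe.1 hm, hrm⟩
        · exact hh
      have hdet : X ∈ detached a c S := ⟨hc.1, fun s hs hcs => hc.2 hhit s hs hcs⟩
      by_cases hwall : X ∈ cellWall D a c S
      · exact Or.inl hwall
      · exact Or.inr ⟨hhit, hdet, hwall⟩
    · have hhd : X ∈ hit a S ∧ X ∈ detached a c S := by
        rcases h with h | h
        · exact ⟨h.1, detached_of_wall hX h⟩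
        · exact ⟨h.1, h.2.1⟩
      obtain ⟨⟨s, hs, hsa⟩, hca, hcs⟩ := hhd
      rw [DualBHK.mem_evXi, Finset.union_empty]
      refine ⟨⟨s, Finset.mem_coe.2 hs, (sG_hub_reach_iff (hE X hX) he1 S).2 (Or.inl hsa)⟩, fun z hz h => ?_⟩
      rw [Set.mem_singleton_iff] at hz
      subst hz
      rw [sG_hub_reach_iff (hE X hX) he1 S] at h
      rcases h with h | ⟨_, s', hs', hcs'⟩
      · exact hca h
      · exact hcs s' hs' hcs'
  -- factor 4: `e₄({c};S) = IN`
  have e4 : PrW D p (DualBHK.evE4 U ∅ a {c} (↑S)) = PrW D p (cellIn a c S) := by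
    refine le_antisymm (PrW_mono D hp0 hp1 fun X hX h => ?_) (PrW_mono D hp0 hp1 fun X hX h => ?_)
    · rw [DualBHK.mem_evE4, Finset.union_empty] at h
      obtain ⟨⟨w, hw, hrw⟩, ⟨m, hm, hrm⟩⟩ := h
      rw [Set.mem_singleton_iff] at hw
      subst hw
      rw [sG_plain_reach_iff (hE X hX) hc1 he1] at hrw hrm
      exact ⟨⟨m, Finset.mem_coe.1 hm, hrm⟩, hrw⟩
    · obtain ⟨⟨s, hs, hsa⟩, hca⟩ := h
      rw [DualBHK.mem_evE4, Finset.union_empty]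
      exact ⟨⟨c, rfl, (sG_plain_reach_iff (hE X hX) hc1 he1).2 hca⟩,
        ⟨s, Finset.mem_coe.2 hs, (sG_plain_reach_iff (hE X hX) hc1 he1).2 hsa⟩⟩
  rw [e1, e2, e3, e4] at hEA
  nlinarith [hEA]

end Split

end RefinedRowR1

end Summit.CriticalPhenomena.PercolationContinuityZ3.Theorems

end
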